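import Summits.ResolutionOfSingularities.ResolutionOfSingularities.Theorems.FrobeniusClosingPatchingRelPerfectTwoPlanesCharts
import HarnessLib

/-!
# Crux `PatchingRelPerfect` (stmt-ResolutionOfSingularities-16161), chain w52 — the rank-two member
# `f = x₀x₁ + x₂³`: chart images of the PLANE AVATAR `J_π` (second repair of the companion)

[OURS · L1 W5.2 · rung, design note NEXT-two-planes-cube.md Addendum 12, kit j288133]  The blow-up
of the point `q` on the `s`-chart of `Bl_{(u,e₀)} B₃` must be followed by the blow-up of the PLANE
`E′_{Π₀} ∩ E_q` before the strict transform of the `A₂` surface can be used as a centre; its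
`S`-avatar is
`J_π = (x₀, x₁x₃, x₂x₃)² + (x₀x₁², x₀x₂², x₁⁴, x₂⁴, x₃⁵) + 𝔪⁵` (the summand `𝔪⁵` changes no
chart image and makes `𝔪⁵ ≤ J_π` trivial).  Its images on the four charts `B_i = S[x/x_i]` of
`Bl_𝔪` (machine-checked over `ℚ`, kit j288133; PROVED here over any ring):

* `map_chartBase_tpJpi_zero` — `J_π B₀ = (u²)`;
* `map_chartBase_tpJpi_one`, `map_chartBase_tpJpi_two` — `J_π B₁ = J_π B₂ = (u²)·(e₀, u)²`
  (a repeat of the plane centre, Cartier after the plane step);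
* `map_chartBase_tpJpi_three` — `J_π B₃ = (u²)·((e₀, u e₁, u e₂)² + (u³))`.

Any commutative ring `S`; nothing here is a statement of the manuscript under review.

## References

* The Stacks Project, Tags 0804, 080B. [StacksProject]
-/

-- `Summit.<Summit>.<Sub>.Theorems` with `Sub = Summit` (single-conjunct summit, D-0017)
set_option linter.dupNamespace false

noncomputable section

open CategoryTheory CategoryTheory.Limits AlgebraicGeometry Literature.AlgebraicGeometry.Resolution
open IsLocalRing

namespace Summit.ResolutionOfSingularities.ResolutionOfSingularities.Theorems

namespace TwoPlanesRung

open ConeRung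

universe u

/-! ## Small membership helpers and shapes (any commutative ring; `ring` is cheap here) -/

section Shapes

variable {B : Type*} [CommRing B]

/-- `d = a b` with `a ∈ I`, `b ∈ J` gives `d ∈ I J`. [folklore] -/
theorem mem_mul_of_eq {I J : Ideal B} {a b d : B} (h : d = a * b) (ha : a ∈ I) (hb : b ∈ J) :
    d ∈ I * J :=
  h ▸ Ideal.mul_mem_mul ha hb

/-- `d = u²·(a b)·c` with `a, b ∈ K` gives `d ∈ (u)²·K²`. [folklore] -/
theorem mem_sq_mul_sq_of_eq (uu : B) (K : Ideal B) {a b d : B} (c : B)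
    (h : d = uu ^ 2 * (a * b) * c) (ha : a ∈ K) (hb : b ∈ K) :
    d ∈ Ideal.span {uu} ^ 2 * K ^ 2 :=
  h ▸ Ideal.mul_mem_right _ _ (Ideal.mul_mem_mul (Ideal.pow_mem_pow (Ideal.mem_span_singleton_self _) 2)
    (by rw [sq]; exact Ideal.mul_mem_mul ha hb))

/-- Shape of `φ(x_j x_k)`. [folklore] -/
theorem shape_pair (u a b : B) : u * a * (u * b) = u * (a * (u * b)) := by ring

/-- Shape of `φ(x₀ x_j²)`. [folklore] -/
theorem shape_f1 (u a b : B) : u * a * (u * b) ^ 2 = u ^ 2 * (a * u) * b ^ 2 := by ring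

/-- Shape of `φ(x₀ x_j²)` on `B₃`. [folklore] -/
theorem shape_f1' (u a b : B) : u * a * (u * b) ^ 2 = u ^ 2 * (a * (u * b)) * b := by ring

/-- Shape of `φ(x_j⁴)`. [folklore] -/
theorem shape_f3 (u b : B) : (u * b) ^ 4 = u ^ 2 * (u * u) * b ^ 4 := by ring

/-- Shape of `φ(x_j⁴)` on `B₃`. [folklore] -/
theorem shape_f3' (u b : B) : (u * b) ^ 4 = u ^ 2 * (u * b * (u * b)) * b ^ 2 := by ring

/-- Shape of `φ(x₃⁵)`. [folklore] -/
theorem shape_f5 (u b : B) : (u * b) ^ 5 = u ^ 2 * (u * u) * (u * b ^ 5) := by ring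

/-- Shape of `u⁵`. [folklore] -/
theorem shape_f6 (u : B) : u ^ 5 = u ^ 2 * (u * u) * u := by ring

/-- Shape of `φ(x₀ x_i²)` on `B_i` (`e_i = 1`), first order. [folklore] -/
theorem shape_gB (u a b : B) (hb : b = 1) : u * a * (u * b) ^ 2 = u * a * (u * u) := by subst hb; ring

/-- Shape of `φ(x₀ x_i²)` on `B_i` (`e_i = 1`), second order. [folklore] -/
theorem shape_gC (u a b : B) (hb : b = 1) : u * a * (u * b) ^ 2 = u * u * (u * a) := by subst hb; ring

/-- Shape of `φ(x_i⁴)` on `B_i` (`e_i = 1`). [folklore] -/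
theorem shape_gD (u b : B) (hb : b = 1) : (u * b) ^ 4 = u * u * (u * u) := by subst hb; ring

/-- Shape of `φ(x₀²)` on `B₀` (`e₀ = 1`). [folklore] -/
theorem shape_g0 (u a : B) (ha : a = 1) : u * a * (u * a) = u ^ 2 := by subst ha; ring

/-- Shape of `φ(x_j x_i)` on `B_i` (`e_i = 1`). [folklore] -/
theorem shape_h13 (u a b : B) (hb : b = 1) : u * a * (u * b) = u * (u * a) := by subst hb; ring

end Shapes

section LevelOnePi

variable {S : Type u} [CommRing S] (x : Fin 4 → S)

local notation3 "M" => Ideal.span (Set.range x)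
/-- the linear part `(x₀, x₁x₃, x₂x₃)` and the extra generators of `J_π` -/
local notation3 "tpP" => Ideal.span {x 0, x 1 * x 3, x 2 * x 3}
local notation3 "tpL" => Ideal.span {x 0 * x 1 ^ 2, x 0 * x 2 ^ 2, x 1 ^ 4, x 2 ^ 4, x 3 ^ 5}
/-- the plane avatar `J_π = (x₀, x₁x₃, x₂x₃)² + (x₀x₁², x₀x₂², x₁⁴, x₂⁴, x₃⁵) + 𝔪⁵` -/
local notation3 "tpJpi" => Ideal.span {x 0, x 1 * x 3, x 2 * x 3} ^ 2 ⊔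
  Ideal.span {x 0 * x 1 ^ 2, x 0 * x 2 ^ 2, x 1 ^ 4, x 2 ^ 4, x 3 ^ 5} ⊔ Ideal.span (Set.range x) ^ 5
/-- chart elements and the target factors -/
local notation3 "u0" => chartBase x 0 (x 0)
local notation3 "u1" => chartBase x 1 (x 1)
local notation3 "u2" => chartBase x 2 (x 2)
local notation3 "u3" => chartBase x 3 (x 3)
local notation3 "K1" => Ideal.span {chartGen x 1 0, chartBase x 1 (x 1)}
local notation3 "K2" => Ideal.span {chartGen x 2 0, chartBase x 2 (x 2)}
local notation3 "K3" => Ideal.span {chartGen x 3 0, chartBase x 3 (x 3) * chartGen x 3 1, chartBase x 3 (x 3) * chartGen x 3 2}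

/-! ### Raw chart images of the generators (uniform in the chart index) -/

/-- `φ_i(x_j) = u e_j`. [cite: StacksProject, Tag 0804] -/
theorem chartBase_x (i j : Fin 4) : chartBase x i (x j) = chartBase x i (x i) * chartGen x i j :=
  reesChartBase_apply_eq_mul_chartGen x i j

/-- `φ_i(x_j x_k) = (u e_j)(u e_k)`. [cite: StacksProject, Tag 0804] -/
theorem chartBase_xx (i j k : Fin 4) :
    chartBase x i (x j * x k) = chartBase x i (x i) * chartGen x i j * (chartBase x i (x i) * chartGen x i k) := by
  rw [map_mul, chartBase_x x i j, chartBase_x x i k]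

/-- `φ_i(x₀ x_j²) = (u e₀)(u e_j)²`. [cite: StacksProject, Tag 0804] -/
theorem chartBase_x0xsq (i j : Fin 4) :
    chartBase x i (x 0 * x j ^ 2) = chartBase x i (x i) * chartGen x i 0 * (chartBase x i (x i) * chartGen x i j) ^ 2 := by
  rw [map_mul, map_pow, chartBase_x x i 0, chartBase_x x i j]

/-- `φ_i(x_jⁿ) = (u e_j)ⁿ`. [cite: StacksProject, Tag 0804] -/
theorem chartBase_xpow (i j : Fin 4) (n : ℕ) :
    chartBase x i (x j ^ n) = (chartBase x i (x i) * chartGen x i j) ^ n := by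
  rw [map_pow, chartBase_x x i j]

/-- An `S`-element of `J_π` gives a `B_i`-element of `J_π B_i`. [folklore] -/
theorem mem_map_tpJpi_of_eq (i : Fin 4) {g : S} {b : chartRing x i} (hg : g ∈ tpJpi)
    (hb : chartBase x i g = b) : b ∈ (tpJpi).map (chartBase x i) :=
  hb ▸ Ideal.mem_map_of_mem (chartBase x i) hg

/-- `x₀² ∈ J_π` (from `(x₀, …)²`). [folklore] -/
theorem x0_sq_mem_tpJpi : x 0 * x 0 ∈ tpJpi :=
  Ideal.mem_sup_left (Ideal.mem_sup_left (by
    rw [sq]; exact Ideal.mul_mem_mul (Ideal.subset_span (by simp)) (Ideal.subset_span (by simp))))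

/-- `x₀x₁² ∈ J_π`. [folklore] -/
theorem x0x1sq_mem_tpJpi : x 0 * x 1 ^ 2 ∈ tpJpi :=
  Ideal.mem_sup_left (Ideal.mem_sup_right (Ideal.subset_span (by simp)))

/-- `x₀x₂² ∈ J_π`. [folklore] -/
theorem x0x2sq_mem_tpJpi : x 0 * x 2 ^ 2 ∈ tpJpi :=
  Ideal.mem_sup_left (Ideal.mem_sup_right (Ideal.subset_span (by simp)))

/-- `x₁⁴ ∈ J_π`. [folklore] -/
theorem x1_four_mem_tpJpi : x 1 ^ 4 ∈ tpJpi :=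
  Ideal.mem_sup_left (Ideal.mem_sup_right (Ideal.subset_span (by simp)))

/-- `x₂⁴ ∈ J_π`. [folklore] -/
theorem x2_four_mem_tpJpi : x 2 ^ 4 ∈ tpJpi :=
  Ideal.mem_sup_left (Ideal.mem_sup_right (Ideal.subset_span (by simp)))

/-- `(𝔪⁵) B_i = (u⁵) ≤ J_π B_i`. [folklore] -/
theorem U_pow_five_le_map_tpJpi (i : Fin 4) :
    Ideal.span {chartBase x i (x i)} ^ 5 ≤ (tpJpi).map (chartBase x i) := by
  rw [← ConeRung.map_chartBase_M x i, ← Ideal.map_pow]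
  exact Ideal.map_mono le_sup_right

/-- The general shape of the `≤` direction: generator-wise bounds for `(x₀,x₁x₃,x₂x₃)B_i` and the
extra generators give a bound for `J_π B_i`. [folklore] -/
theorem map_tpJpi_le (i : Fin 4) (K : Ideal (chartRing x i))
    (h0 : chartBase x i (x 0) ∈ Ideal.span {chartBase x i (x i)} * K)
    (h13 : chartBase x i (x 1 * x 3) ∈ Ideal.span {chartBase x i (x i)} * K)
    (h23 : chartBase x i (x 2 * x 3) ∈ Ideal.span {chartBase x i (x i)} * K)
    (l1 : chartBase x i (x 0 * x 1 ^ 2) ∈ Ideal.span {chartBase x i (x i)} ^ 2 * K ^ 2)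
    (l2 : chartBase x i (x 0 * x 2 ^ 2) ∈ Ideal.span {chartBase x i (x i)} ^ 2 * K ^ 2)
    (l3 : chartBase x i (x 1 ^ 4) ∈ Ideal.span {chartBase x i (x i)} ^ 2 * K ^ 2)
    (l4 : chartBase x i (x 2 ^ 4) ∈ Ideal.span {chartBase x i (x i)} ^ 2 * K ^ 2)
    (l5 : chartBase x i (x 3 ^ 5) ∈ Ideal.span {chartBase x i (x i)} ^ 2 * K ^ 2)
    (h5 : chartBase x i (x i) ^ 5 ∈ Ideal.span {chartBase x i (x i)} ^ 2 * K ^ 2) :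
    (tpJpi).map (chartBase x i) ≤ Ideal.span {chartBase x i (x i)} ^ 2 * K ^ 2 := by
  have hP : (tpP).map (chartBase x i) ≤ Ideal.span {chartBase x i (x i)} * K := by
    rw [Ideal.map_span, Set.image_insert_eq, Set.image_insert_eq, Set.image_singleton, Ideal.span_le]
    exact Set.insert_subset_iff.mpr ⟨h0, Set.insert_subset_iff.mpr ⟨h13, Set.singleton_subset_iff.mpr h23⟩⟩
  have hL : (tpL).map (chartBase x i) ≤ Ideal.span {chartBase x i (x i)} ^ 2 * K ^ 2 := by
    rw [Ideal.map_span, Set.image_insert_eq, Set.image_insert_eq, Set.image_insert_eq, Set.image_insert_eq,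
      Set.image_singleton, Ideal.span_le]
    exact Set.insert_subset_iff.mpr ⟨l1, Set.insert_subset_iff.mpr ⟨l2, Set.insert_subset_iff.mpr ⟨l3,
      Set.insert_subset_iff.mpr ⟨l4, Set.singleton_subset_iff.mpr l5⟩⟩⟩⟩
  have hM : (M ^ 5).map (chartBase x i) ≤ Ideal.span {chartBase x i (x i)} ^ 2 * K ^ 2 := by
    rw [Ideal.map_pow, ConeRung.map_chartBase_M, Ideal.span_singleton_pow, Ideal.span_singleton_le_iff_mem]
    exact h5
  rw [Ideal.map_sup, Ideal.map_sup, Ideal.map_pow]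
  exact sup_le (sup_le ((Ideal.pow_right_mono hP 2).trans (mul_pow _ _ 2).le) hL) hM

/-! ### Chart `B₀` -/

/-- **`J_π B₀ = (u²)`.** [cite: StacksProject, Tag 080B] -/
theorem map_chartBase_tpJpi_zero :
    (tpJpi).map (chartBase x 0) = Ideal.span {chartBase x 0 (x 0)} ^ 2 := by
  have hu : u0 ∈ Ideal.span {u0} := Ideal.mem_span_singleton_self _
  have h1 : ∀ b : chartRing x 0, b ∈ (⊤ : Ideal (chartRing x 0)) := fun _ => Submodule.mem_top
  apply le_antisymm
  · refine (map_tpJpi_le x 0 ⊤ (mem_mul_of_eq (chartBase_x x 0 0) hu (h1 _))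
      (mem_mul_of_eq ((chartBase_xx x 0 1 3).trans (shape_pair u0 (chartGen x 0 1) (chartGen x 0 3))) hu (h1 _))
      (mem_mul_of_eq ((chartBase_xx x 0 2 3).trans (shape_pair u0 (chartGen x 0 2) (chartGen x 0 3))) hu (h1 _))
      (mem_sq_mul_sq_of_eq u0 ⊤ (chartGen x 0 1 ^ 2)
        ((chartBase_x0xsq x 0 1).trans (shape_f1 u0 (chartGen x 0 0) (chartGen x 0 1))) (h1 _) (h1 _))
      (mem_sq_mul_sq_of_eq u0 ⊤ (chartGen x 0 2 ^ 2)
        ((chartBase_x0xsq x 0 2).trans (shape_f1 u0 (chartGen x 0 0) (chartGen x 0 2))) (h1 _) (h1 _))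
      (mem_sq_mul_sq_of_eq u0 ⊤ (chartGen x 0 1 ^ 4)
        ((chartBase_xpow x 0 1 4).trans (shape_f3 u0 (chartGen x 0 1))) (h1 _) (h1 _))
      (mem_sq_mul_sq_of_eq u0 ⊤ (chartGen x 0 2 ^ 4)
        ((chartBase_xpow x 0 2 4).trans (shape_f3 u0 (chartGen x 0 2))) (h1 _) (h1 _))
      (mem_sq_mul_sq_of_eq u0 ⊤ (u0 * chartGen x 0 3 ^ 5)
        ((chartBase_xpow x 0 3 5).trans (shape_f5 u0 (chartGen x 0 3))) (h1 _) (h1 _))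
      (mem_sq_mul_sq_of_eq u0 ⊤ u0 (shape_f6 u0) (h1 _) (h1 _))).trans (le_of_eq ?_)
    rw [← Ideal.one_eq_top, one_pow, mul_one]
  · rw [Ideal.span_singleton_pow, Ideal.span_singleton_le_iff_mem]
    exact mem_map_tpJpi_of_eq x 0 (x0_sq_mem_tpJpi x)
      ((chartBase_xx x 0 0 0).trans (shape_g0 u0 (chartGen x 0 0) (chartGen_self x 0)))

/-! ### Charts `B₁`, `B₂` -/

/-- **`J_π B₁ = (u²)·(e₀, u)²`.** [cite: StacksProject, Tag 080B] -/
theorem map_chartBase_tpJpi_one : (tpJpi).map (chartBase x 1) =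
    Ideal.span {chartBase x 1 (x 1)} ^ 2 * Ideal.span {chartGen x 1 0, chartBase x 1 (x 1)} ^ 2 := by
  have he0 : chartGen x 1 0 ∈ K1 := Ideal.subset_span (by simp)
  have hu : u1 ∈ K1 := Ideal.subset_span (by simp)
  have hue : ∀ a b, a * (u1 * b) ∈ K1 := fun a b => Ideal.mul_mem_left _ a (Ideal.mul_mem_right b _ hu)
  have hu1 : u1 ∈ Ideal.span {u1} := Ideal.mem_span_singleton_self _
  have h11 : chartGen x 1 1 = 1 := chartGen_self x 1
  apply le_antisymm
  · exact map_tpJpi_le x 1 K1 (mem_mul_of_eq (chartBase_x x 1 0) hu1 he0)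
      (mem_mul_of_eq ((chartBase_xx x 1 1 3).trans (shape_pair u1 (chartGen x 1 1) (chartGen x 1 3))) hu1
        (hue _ _))
      (mem_mul_of_eq ((chartBase_xx x 1 2 3).trans (shape_pair u1 (chartGen x 1 2) (chartGen x 1 3))) hu1
        (hue _ _))
      (mem_sq_mul_sq_of_eq u1 K1 (chartGen x 1 1 ^ 2)
        ((chartBase_x0xsq x 1 1).trans (shape_f1 u1 (chartGen x 1 0) (chartGen x 1 1))) he0 hu)
      (mem_sq_mul_sq_of_eq u1 K1 (chartGen x 1 2 ^ 2)
        ((chartBase_x0xsq x 1 2).trans (shape_f1 u1 (chartGen x 1 0) (chartGen x 1 2))) he0 hu)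
      (mem_sq_mul_sq_of_eq u1 K1 (chartGen x 1 1 ^ 4)
        ((chartBase_xpow x 1 1 4).trans (shape_f3 u1 (chartGen x 1 1))) hu hu)
      (mem_sq_mul_sq_of_eq u1 K1 (chartGen x 1 2 ^ 4)
        ((chartBase_xpow x 1 2 4).trans (shape_f3 u1 (chartGen x 1 2))) hu hu)
      (mem_sq_mul_sq_of_eq u1 K1 (u1 * chartGen x 1 3 ^ 5)
        ((chartBase_xpow x 1 3 5).trans (shape_f5 u1 (chartGen x 1 3))) hu hu)
      (mem_sq_mul_sq_of_eq u1 K1 u1 (shape_f6 u1) hu hu)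
  · rw [← mul_pow, ConeRung.span_singleton_mul_span_pair, sq, Ideal.span_pair_mul_span_pair, Ideal.span_le]
    exact Set.insert_subset_iff.mpr ⟨mem_map_tpJpi_of_eq x 1 (x0_sq_mem_tpJpi x) (chartBase_xx x 1 0 0),
      Set.insert_subset_iff.mpr ⟨mem_map_tpJpi_of_eq x 1 (x0x1sq_mem_tpJpi x)
        ((chartBase_x0xsq x 1 1).trans (shape_gB u1 (chartGen x 1 0) (chartGen x 1 1) h11)),
      Set.insert_subset_iff.mpr ⟨mem_map_tpJpi_of_eq x 1 (x0x1sq_mem_tpJpi x)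
        ((chartBase_x0xsq x 1 1).trans (shape_gC u1 (chartGen x 1 0) (chartGen x 1 1) h11)),
      Set.singleton_subset_iff.mpr (mem_map_tpJpi_of_eq x 1 (x1_four_mem_tpJpi x)
        ((chartBase_xpow x 1 1 4).trans (shape_gD u1 (chartGen x 1 1) h11)))⟩⟩⟩

/-- **`J_π B₂ = (u²)·(e₀, u)²`.** [cite: StacksProject, Tag 080B] -/
theorem map_chartBase_tpJpi_two : (tpJpi).map (chartBase x 2) =
    Ideal.span {chartBase x 2 (x 2)} ^ 2 * Ideal.span {chartGen x 2 0, chartBase x 2 (x 2)} ^ 2 := by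
  have he0 : chartGen x 2 0 ∈ K2 := Ideal.subset_span (by simp)
  have hu : u2 ∈ K2 := Ideal.subset_span (by simp)
  have hue : ∀ a b, a * (u2 * b) ∈ K2 := fun a b => Ideal.mul_mem_left _ a (Ideal.mul_mem_right b _ hu)
  have hu1 : u2 ∈ Ideal.span {u2} := Ideal.mem_span_singleton_self _
  have h22 : chartGen x 2 2 = 1 := chartGen_self x 2
  apply le_antisymm
  · exact map_tpJpi_le x 2 K2 (mem_mul_of_eq (chartBase_x x 2 0) hu1 he0)
      (mem_mul_of_eq ((chartBase_xx x 2 1 3).trans (shape_pair u2 (chartGen x 2 1) (chartGen x 2 3))) hu1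
        (hue _ _))
      (mem_mul_of_eq ((chartBase_xx x 2 2 3).trans (shape_pair u2 (chartGen x 2 2) (chartGen x 2 3))) hu1
        (hue _ _))
      (mem_sq_mul_sq_of_eq u2 K2 (chartGen x 2 1 ^ 2)
        ((chartBase_x0xsq x 2 1).trans (shape_f1 u2 (chartGen x 2 0) (chartGen x 2 1))) he0 hu)
      (mem_sq_mul_sq_of_eq u2 K2 (chartGen x 2 2 ^ 2)
        ((chartBase_x0xsq x 2 2).trans (shape_f1 u2 (chartGen x 2 0) (chartGen x 2 2))) he0 hu)
      (mem_sq_mul_sq_of_eq u2 K2 (chartGen x 2 1 ^ 4)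
        ((chartBase_xpow x 2 1 4).trans (shape_f3 u2 (chartGen x 2 1))) hu hu)
      (mem_sq_mul_sq_of_eq u2 K2 (chartGen x 2 2 ^ 4)
        ((chartBase_xpow x 2 2 4).trans (shape_f3 u2 (chartGen x 2 2))) hu hu)
      (mem_sq_mul_sq_of_eq u2 K2 (u2 * chartGen x 2 3 ^ 5)
        ((chartBase_xpow x 2 3 5).trans (shape_f5 u2 (chartGen x 2 3))) hu hu)
      (mem_sq_mul_sq_of_eq u2 K2 u2 (shape_f6 u2) hu hu)
  · rw [← mul_pow, ConeRung.span_singleton_mul_span_pair, sq, Ideal.span_pair_mul_span_pair, Ideal.span_le]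
    exact Set.insert_subset_iff.mpr ⟨mem_map_tpJpi_of_eq x 2 (x0_sq_mem_tpJpi x) (chartBase_xx x 2 0 0),
      Set.insert_subset_iff.mpr ⟨mem_map_tpJpi_of_eq x 2 (x0x2sq_mem_tpJpi x)
        ((chartBase_x0xsq x 2 2).trans (shape_gB u2 (chartGen x 2 0) (chartGen x 2 2) h22)),
      Set.insert_subset_iff.mpr ⟨mem_map_tpJpi_of_eq x 2 (x0x2sq_mem_tpJpi x)
        ((chartBase_x0xsq x 2 2).trans (shape_gC u2 (chartGen x 2 0) (chartGen x 2 2) h22)),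
      Set.singleton_subset_iff.mpr (mem_map_tpJpi_of_eq x 2 (x2_four_mem_tpJpi x)
        ((chartBase_xpow x 2 2 4).trans (shape_gD u2 (chartGen x 2 2) h22)))⟩⟩⟩

/-! ### Chart `B₃` -/

/-- On `B₃`: `(x₀, x₁x₃, x₂x₃) B₃ = (u)·(e₀, u e₁, u e₂)`. [cite: StacksProject, Tag 080B] -/
theorem map_chartBase_tpP_three : (tpP).map (chartBase x 3) = Ideal.span {chartBase x 3 (x 3)} *
    Ideal.span {chartGen x 3 0, chartBase x 3 (x 3) * chartGen x 3 1, chartBase x 3 (x 3) * chartGen x 3 2} := by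
  have h33 : chartGen x 3 3 = 1 := chartGen_self x 3
  have h1 : chartBase x 3 (x 1 * x 3) = u3 * (u3 * chartGen x 3 1) :=
    (chartBase_xx x 3 1 3).trans (shape_h13 u3 (chartGen x 3 1) (chartGen x 3 3) h33)
  have h2 : chartBase x 3 (x 2 * x 3) = u3 * (u3 * chartGen x 3 2) :=
    (chartBase_xx x 3 2 3).trans (shape_h13 u3 (chartGen x 3 2) (chartGen x 3 3) h33)
  rw [Ideal.map_span, Set.image_insert_eq, Set.image_insert_eq, Set.image_singleton,
    ConeRung.span_singleton_mul_span_triple, chartBase_x x 3 0, h1, h2]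

/-- On `B₃`: the extra generators map into `(u²)·(e₀, u e₁, u e₂)² + (u⁵)`. [cite: StacksProject, Tag 080B] -/
theorem map_tpL_three_le : (tpL).map (chartBase x 3) ≤ Ideal.span {chartBase x 3 (x 3)} ^ 2 *
    Ideal.span {chartGen x 3 0, chartBase x 3 (x 3) * chartGen x 3 1, chartBase x 3 (x 3) * chartGen x 3 2} ^ 2 ⊔
      Ideal.span {chartBase x 3 (x 3)} ^ (2 + 3) := by
  have he0 : chartGen x 3 0 ∈ K3 := Ideal.subset_span (by simp)
  have he1 : u3 * chartGen x 3 1 ∈ K3 := Ideal.subset_span (by simp)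
  have he2 : u3 * chartGen x 3 2 ∈ K3 := Ideal.subset_span (by simp)
  have f5 : chartBase x 3 (x 3 ^ 5) ∈ Ideal.span {u3} ^ (2 + 3) := by
    rw [map_pow, Ideal.span_singleton_pow]; exact Ideal.mem_span_singleton_self _
  rw [Ideal.map_span, Set.image_insert_eq, Set.image_insert_eq, Set.image_insert_eq, Set.image_insert_eq,
    Set.image_singleton, Ideal.span_le]
  exact Set.insert_subset_iff.mpr ⟨Ideal.mem_sup_left (mem_sq_mul_sq_of_eq u3 K3 (chartGen x 3 1)
      ((chartBase_x0xsq x 3 1).trans (shape_f1' u3 (chartGen x 3 0) (chartGen x 3 1))) he0 he1),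
    Set.insert_subset_iff.mpr ⟨Ideal.mem_sup_left (mem_sq_mul_sq_of_eq u3 K3 (chartGen x 3 2)
      ((chartBase_x0xsq x 3 2).trans (shape_f1' u3 (chartGen x 3 0) (chartGen x 3 2))) he0 he2),
    Set.insert_subset_iff.mpr ⟨Ideal.mem_sup_left (mem_sq_mul_sq_of_eq u3 K3 (chartGen x 3 1 ^ 2)
      ((chartBase_xpow x 3 1 4).trans (shape_f3' u3 (chartGen x 3 1))) he1 he1),
    Set.insert_subset_iff.mpr ⟨Ideal.mem_sup_left (mem_sq_mul_sq_of_eq u3 K3 (chartGen x 3 2 ^ 2)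
      ((chartBase_xpow x 3 2 4).trans (shape_f3' u3 (chartGen x 3 2))) he2 he2),
    Set.singleton_subset_iff.mpr (Ideal.mem_sup_right f5)⟩⟩⟩⟩

/-- **`J_π B₃ = (u²)·((e₀, u e₁, u e₂)² + (u³))`.** [cite: StacksProject, Tag 080B] -/
theorem map_chartBase_tpJpi_three : (tpJpi).map (chartBase x 3) = Ideal.span {chartBase x 3 (x 3)} ^ 2 *
    (Ideal.span {chartGen x 3 0, chartBase x 3 (x 3) * chartGen x 3 1, chartBase x 3 (x 3) * chartGen x 3 2} ^ 2 ⊔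
      Ideal.span {chartBase x 3 (x 3)} ^ 3) := by
  have hP3 : (tpP ^ 2).map (chartBase x 3) = Ideal.span {u3} ^ 2 * K3 ^ 2 := by
    rw [Ideal.map_pow, map_chartBase_tpP_three, mul_pow]
  have hM : (M ^ 5).map (chartBase x 3) = Ideal.span {u3} ^ (2 + 3) := by
    rw [Ideal.map_pow, ConeRung.map_chartBase_M]
  rw [Ideal.mul_sup, ← pow_add, Ideal.map_sup, Ideal.map_sup, hP3, hM]
  exact le_antisymm (sup_le (sup_le le_sup_left (map_tpL_three_le x)) le_sup_right)
    (sup_le (le_sup_left.trans le_sup_left) le_sup_right)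

end LevelOnePi

end TwoPlanesRung

end Summit.ResolutionOfSingularities.ResolutionOfSingularities.Theorems

end
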